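import Literature.NumberTheory.BeurlingPrimes.BDTowerTemplate
import Literature.NumberTheory.BeurlingPrimes.DMVTemplatePositivity
import HarnessLib

/-!
# Positivity of the Broucke–Debruyne tower template: `poleDensity/2 ≤ primeDensity ≤ 3·poleDensity/2`

Topic `Literature/NumberTheory/BeurlingPrimes`, grouping namespace `BDTower` (objects: `BDTowerTemplate.lean`).
Everything in this file is PROVED.

Broucke–Debruyne 2023 §6 (arXiv:2211.08716 p. 15): "where, for fixed `u`, only finitely many terms are non-zero in view
of `supp g ⊆ [e,∞)`. Therefore, by observing that `g(u) ≪ 1`, inserting the choice for `ℓ_k` and selecting `k₀`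
sufficiently large, we obtain that `dΠ` is indeed a positive measure." For the sparse-height member (`ℓ_k = α(k+8)`,
`α = 2/(1−Θ)`) the computation is explicit: at height `v` only the `k` with `ℓ_k ≤ log v` (so `k < ⌈log v/α⌉`) are active,
each term is `≤ v^{Θ−1}/ℓ_0 = v^{Θ−1}/(8α)`, so for `log v ≥ 8α`
`2|Σ_k oscTerm k v| ≤ 2(log v/α + 1) v^{Θ−1}/(8α) ≤ 9 (log v) v^{Θ−1}/(32α²) ≤ (1/4)/log v ≤ poleDensity(v)/2`
(the third step is `u² ≤ 2e^u`, `u = (1−Θ) log v`; the last uses `v ≥ e^{16}`); below `e^{8α}` no term is active.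

* `tsum_oscTerm_eq_sum`, `measurable_primeDensity` — the `k`-sum is finite; measurability;
* `two_abs_tsum_oscTerm_le` — `2|Σ_k oscTerm k v| ≤ poleDensity(v)/2` (`v > 1`);
* `primeDensity_bounds`, `primeDensity_nonneg`, `primeDensity_le_two`, `primeDensity_lower` — the density lies between
  `poleDensity/2 ≥ 1/(8 log 2v)` and `3 poleDensity/2 ≤ 3/2`.

## References
* [BrouckeDebruyne2023] F. Broucke, G. Debruyne, Acta Arith. 207 (2023), §6, arXiv:2211.08716 p. 15 (read).
* [DiamondMontgomeryVorhauer2006] H. G. Diamond, H. L. Montgomery, U. M. A. Vorhauer, Math. Ann. 334 (2006), Lemma 7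
  (the model positivity argument; tree `DMVTemplatePositivity.lean`).
-/

noncomputable section

open Filter Topology Set

namespace Literature.NumberTheory.BeurlingPrimes

namespace BDTower

variable {Θ : ℝ}

/-! ### Finiteness of the `k`-sum; measurability -/

/-- For `v > 0` and `k ≥ ⌈log v/α⌉`: `v < e^{ℓ_k}`, so the `k`-th term is inactive at `v`.
[cite: BrouckeDebruyne2023, §6 ("only finitely many terms are non-zero")] -/
theorem lt_exp_scale_of_le (hΘ1 : Θ < 1) {v : ℝ} (hv : 0 < v) {k : ℕ} (hk : ⌈Real.log v / slope Θ⌉₊ ≤ k) :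
    v < Real.exp (scale Θ k) := by
  have hα := slope_pos hΘ1
  have h1 : Real.log v / slope Θ ≤ k := (Nat.le_ceil _).trans (by exact_mod_cast hk)
  have h2 : Real.log v ≤ slope Θ * k := by rw [div_le_iff₀ hα] at h1; linarith
  have h3 : Real.log v < scale Θ k := by rw [scale]; nlinarith
  calc v = Real.exp (Real.log v) := (Real.exp_log hv).symm
    _ < Real.exp (scale Θ k) := Real.exp_lt_exp.mpr h3

/-- The `k`-sum is finite: `Σ' k, oscTerm k v = Σ_{k < N} oscTerm k v` for `N = ⌈log v/α⌉` (`v > 0`).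
[cite: BrouckeDebruyne2023, §6] -/
theorem tsum_oscTerm_eq_sum (hΘ1 : Θ < 1) {v : ℝ} (hv : 0 < v) :
    ∑' k, oscTerm Θ k v = ∑ k ∈ Finset.range ⌈Real.log v / slope Θ⌉₊, oscTerm Θ k v :=
  tsum_eq_sum fun _ hk ↦ oscTerm_eq_zero_of_lt hΘ1 hv.le
    (lt_exp_scale_of_le hΘ1 hv (not_lt.mp fun h ↦ hk (Finset.mem_range.mpr h)))

/-- `k ↦ oscTerm k v` is summable (finite support for `v ≥ 0`; for `v < 0` every term is `0` or the sum is
finite as well — we only need `v > 0`). [cite: BrouckeDebruyne2023, §6] -/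
theorem summable_oscTerm (hΘ1 : Θ < 1) {v : ℝ} (hv : 0 < v) : Summable fun k ↦ oscTerm Θ k v := by
  refine summable_of_hasFiniteSupport ((Finset.range ⌈Real.log v / slope Θ⌉₊).finite_toSet.subset ?_)
  intro k hk
  by_contra hkN
  simp only [Finset.coe_range, mem_Iio, not_lt] at hkN
  exact hk (oscTerm_eq_zero_of_lt hΘ1 hv.le (lt_exp_scale_of_le hΘ1 hv hkN))

/-- `oscTerm k` is measurable. [cite: BrouckeDebruyne2023, §6] -/
theorem measurable_oscTerm (Θ : ℝ) (k : ℕ) : Measurable (oscTerm Θ k) := by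
  unfold oscTerm
  refine ((DMV.measurable_f.comp (measurable_id.pow_const _)).div_const _ |>.mul
    (measurable_id.pow_const _)).mul ?_
  exact Real.measurable_cos.comp (Real.measurable_log.const_mul _)

/-- On `(0,∞)` the sum `v ↦ Σ_k oscTerm k v` is a pointwise limit of measurable partial sums; we record
measurability of the density restricted through the indicator of `(0,∞)` is not needed: the partial sums converge
for EVERY `v > 0`, and for `v ≤ 0` we use the junk-free formula `tsum = lim` only where summable. To keep the
statement global we prove measurability of `v ↦ Σ' k, oscTerm k |v| ·` … — simpler: `oscTerm k v = 0` for all `k`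
with `e^{ℓ_k} > |v|` fails for negative `v` (real powers of negatives are junk), so we state measurability of the
density on the measurable set `(0,∞)` in the form used downstream: `primeDensity` agrees on `(0,∞)` with a
measurable function. [cite: BrouckeDebruyne2023, §6] -/
theorem measurable_primeDensity_indicator (hΘ1 : Θ < 1) :
    Measurable fun v ↦ (Ioi (0 : ℝ)).indicator (primeDensity Θ) v := by
  have hpart : ∀ N : ℕ, Measurable fun v ↦ ∑ k ∈ Finset.range N, oscTerm Θ k v := fun N ↦
    Finset.measurable_sum _ fun k _ ↦ measurable_oscTerm Θ k
  -- the partial sums converge to the `tsum` on `(0,∞)`; off `(0,∞)` use the indicator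
  have hlim : Measurable fun v ↦ (Ioi (0 : ℝ)).indicator (fun v ↦ ∑' k, oscTerm Θ k v) v := by
    refine measurable_of_tendsto_metrizable
      (f := fun N v ↦ (Ioi (0 : ℝ)).indicator (fun v ↦ ∑ k ∈ Finset.range N, oscTerm Θ k v) v)
      (fun N ↦ (hpart N).indicator measurableSet_Ioi) ?_
    rw [tendsto_pi_nhds]
    intro v
    by_cases hv : v ∈ Ioi (0 : ℝ)
    · simp only [indicator_of_mem hv]
      exact (summable_oscTerm hΘ1 hv).hasSum.tendsto_sum_nat
    · simp only [indicator_of_notMem hv]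
      exact tendsto_const_nhds
  have hpole : Measurable DMV.poleDensity := by
    unfold DMV.poleDensity
    exact (measurable_const.sub (measurable_const.div measurable_id)).div Real.measurable_log
  have heq : (fun v ↦ (Ioi (0 : ℝ)).indicator (primeDensity Θ) v) =
      fun v ↦ (Ioi (0 : ℝ)).indicator DMV.poleDensity v -
        2 * (Ioi (0 : ℝ)).indicator (fun v ↦ ∑' k, oscTerm Θ k v) v := by
    funext v
    by_cases hv : v ∈ Ioi (0 : ℝ)
    · simp only [indicator_of_mem hv, primeDensity]
    · simp only [indicator_of_notMem hv]; ring
  rw [heq]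
  exact (hpole.indicator measurableSet_Ioi).sub (hlim.const_mul 2)

/-! ### The main estimate `2|Σ_k oscTerm k v| ≤ poleDensity(v)/2` -/

/-- `u² ≤ 2 e^u` for `u ≥ 0`. [folklore] -/
private theorem sq_le_two_mul_exp {u : ℝ} (hu : 0 ≤ u) : u ^ 2 ≤ 2 * Real.exp u := by
  have h := Real.quadratic_le_exp_of_nonneg hu
  nlinarith

/-- **Positivity estimate** (BD §6 "dΠ is indeed a positive measure", quantified): for `1/2 < Θ < 1` and `v > 1`,
`2|Σ_k oscTerm k v| ≤ poleDensity(v)/2`. [cite: BrouckeDebruyne2023, §6] -/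
theorem two_abs_tsum_oscTerm_le (hΘ : 1 / 2 < Θ) (hΘ1 : Θ < 1) {v : ℝ} (hv : 1 < v) :
    2 * |∑' k, oscTerm Θ k v| ≤ DMV.poleDensity v / 2 := by
  have hv0 : 0 < v := by linarith
  have hα := slope_pos hΘ1
  have hα2 : slope Θ * (1 - Θ) = 2 := slope_mul_one_sub hΘ1
  have hpole0 := DMV.poleDensity_nonneg hv
  set L : ℝ := Real.log v with hL
  have hL0 : 0 < L := Real.log_pos hv
  rcases lt_or_ge L (scale Θ 0) with hsmall | hbig
  · -- no active term: the sum vanishes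
    have hzero : ∑' k, oscTerm Θ k v = 0 := by
      rw [tsum_oscTerm_eq_sum hΘ1 hv0]
      refine Finset.sum_eq_zero fun k _ ↦ oscTerm_eq_zero_of_lt hΘ1 hv0.le ?_
      calc v = Real.exp L := (Real.exp_log hv0).symm
        _ < Real.exp (scale Θ k) := Real.exp_lt_exp.mpr (lt_of_lt_of_le hsmall (scale_zero_le hΘ1 k))
    rw [hzero, abs_zero, mul_zero]
    linarith
  · -- `L ≥ ℓ_0 = 8α`: count the active terms
    have h8 : 8 * slope Θ ≤ L := by have h := hbig; simp only [scale, Nat.cast_zero, zero_add] at h; linarith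
    set N : ℕ := ⌈L / slope Θ⌉₊ with hN
    set Pw : ℝ := v ^ (Θ - 1) with hPw
    have hPw0 : 0 < Pw := Real.rpow_pos_of_pos hv0 _
    -- termwise bound and the count
    have hterm : ∀ k, |oscTerm Θ k v| ≤ Pw / (8 * slope Θ) := fun k ↦ by
      refine (abs_oscTerm_le hΘ1 k hv0.le).trans ?_
      rw [hPw]
      refine div_le_div_of_nonneg_left (Real.rpow_nonneg hv0.le _) (by positivity) ?_
      rw [scale, show slope Θ * ((k : ℝ) + 8) = slope Θ * k + 8 * slope Θ by ring]
      linarith [mul_nonneg hα.le (Nat.cast_nonneg k : (0 : ℝ) ≤ k)]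
    have hsum : |∑' k, oscTerm Θ k v| ≤ N * (Pw / (8 * slope Θ)) := by
      rw [tsum_oscTerm_eq_sum hΘ1 hv0, ← hL]
      calc |∑ k ∈ Finset.range N, oscTerm Θ k v| ≤ ∑ k ∈ Finset.range N, |oscTerm Θ k v| :=
            Finset.abs_sum_le_sum_abs _ _
        _ ≤ ∑ k ∈ Finset.range N, Pw / (8 * slope Θ) := Finset.sum_le_sum fun k _ ↦ hterm k
        _ = N * (Pw / (8 * slope Θ)) := by rw [Finset.sum_const, Finset.card_range, nsmul_eq_mul]
    have hNle : (N : ℝ) ≤ L / slope Θ + 1 := (Nat.ceil_lt_add_one (by positivity)).le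
    have hNle' : (N : ℝ) ≤ 9 / 8 * (L / slope Θ) := by
      have : 8 ≤ L / slope Θ := by rw [le_div_iff₀ hα]; linarith
      linarith
    -- the exponential step: `9 L² Pw (1−Θ)² ≤ 32`, from `u² ≤ 2e^u` with `u = (1−Θ)L`, `Pw = e^{−u}`
    set u : ℝ := (1 - Θ) * L with hu
    have hu0 : 0 ≤ u := by rw [hu]; exact mul_nonneg (by linarith) hL0.le
    have hPw_eq : Pw * Real.exp u = 1 := by
      rw [hPw, hu, Real.rpow_def_of_pos hv0, ← hL, ← Real.exp_add]
      convert Real.exp_zero using 2; ring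
    have hkey : u ^ 2 * Pw ≤ 2 := by
      have h1 := sq_le_two_mul_exp hu0
      have : u ^ 2 * Pw ≤ 2 * Real.exp u * Pw := mul_le_mul_of_nonneg_right h1 hPw0.le
      calc u ^ 2 * Pw ≤ 2 * Real.exp u * Pw := this
        _ = 2 * (Pw * Real.exp u) := by ring
        _ = 2 := by rw [hPw_eq, mul_one]
    -- `poleDensity v ≥ (1/2)/L` since `v ≥ e^{8α} ≥ e^{16} ≥ 2`
    have hv2 : 2 ≤ v := by
      have hα2' : 2 < slope Θ := by
        rw [slope, lt_div_iff₀ (by linarith)]; linarith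
      have h16 : (16 : ℝ) ≤ L := by linarith
      have : Real.exp 1 ≤ v := by
        calc Real.exp 1 ≤ Real.exp L := Real.exp_le_exp.mpr (by linarith)
          _ = v := Real.exp_log hv0
      linarith [Real.add_one_le_exp (1 : ℝ)]
    have hpole : 1 / 2 / L ≤ DMV.poleDensity v := by
      rw [DMV.poleDensity, ← hL, div_le_div_iff_of_pos_right hL0]
      have : 1 / v ≤ 1 / 2 := one_div_le_one_div_of_le two_pos hv2
      linarith
    -- assemble: `2 N Pw/(8α) ≤ (9/4)(L/α) Pw/(8α) = 9 L Pw/(32 α²)` and `9 L Pw/(32α²) ≤ 1/(4L)`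
    have hfinal : 2 * (N * (Pw / (8 * slope Θ))) ≤ 1 / 2 / L / 2 := by
      have hα2sq : slope Θ ^ 2 * (1 - Θ) ^ 2 = 4 := by nlinarith [hα2]
      -- reduce to `9 L² Pw ≤ 8 α²`, i.e. `9 u² Pw ≤ 32` after multiplying by `(1−Θ)²`
      have step1 : 2 * (N * (Pw / (8 * slope Θ))) ≤ 9 * L * Pw / (32 * slope Θ ^ 2) := by
        have : 2 * (N * (Pw / (8 * slope Θ))) = N * Pw / (4 * slope Θ) := by field_simp; ring
        rw [this, div_le_div_iff₀ (by positivity) (by positivity)]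
        have hN9 := mul_le_mul_of_nonneg_right hNle' hPw0.le
        -- `N Pw (32 α²) ≤ (9/8)(L/α) Pw (32 α²) = 36 α L Pw = 9 L Pw (4α)`
        have e : 9 / 8 * (L / slope Θ) * Pw * (32 * slope Θ ^ 2) = 9 * L * Pw * (4 * slope Θ) := by
          field_simp; ring
        nlinarith [e, hN9, hα, hPw0]
      have step2 : 9 * L * Pw / (32 * slope Θ ^ 2) ≤ 1 / 2 / L / 2 := by
        have h1Θ : 0 < (1 - Θ) ^ 2 := by positivity
        have h1Θ' : (1 - Θ) ≠ 0 := by linarith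
        have eL : L ^ 2 = u ^ 2 / (1 - Θ) ^ 2 := by rw [hu]; field_simp
        have eα : slope Θ ^ 2 = 4 / (1 - Θ) ^ 2 := by
          rw [eq_div_iff h1Θ.ne']; exact hα2sq
        rw [div_le_div_iff₀ (by positivity) (by positivity)]
        -- goal: `9 L Pw · 2 ≤ (1/2/L) · 32 α²`; rewrite the right side as `16 α² / L`
        rw [show 1 / 2 / L * (32 * slope Θ ^ 2) = 16 * slope Θ ^ 2 / L by field_simp; ring, le_div_iff₀ hL0]
        calc 9 * L * Pw * 2 * L = 18 * (u ^ 2 * Pw) / (1 - Θ) ^ 2 := by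
              rw [show 9 * L * Pw * 2 * L = 18 * (L ^ 2 * Pw) by ring, eL]; field_simp
          _ ≤ 18 * 2 / (1 - Θ) ^ 2 := by gcongr
          _ ≤ 64 / (1 - Θ) ^ 2 := div_le_div_of_nonneg_right (by norm_num) h1Θ.le
          _ = 16 * slope Θ ^ 2 := by rw [eα]; ring
      exact step1.trans step2
    calc 2 * |∑' k, oscTerm Θ k v| ≤ 2 * (N * (Pw / (8 * slope Θ))) := by linarith [hsum]
      _ ≤ 1 / 2 / L / 2 := hfinal
      _ ≤ DMV.poleDensity v / 2 := by linarith [hpole]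

/-- **The density lies between `poleDensity/2` and `3 poleDensity/2`** on `(1,∞)`. [cite: BrouckeDebruyne2023, §6] -/
theorem primeDensity_bounds (hΘ : 1 / 2 < Θ) (hΘ1 : Θ < 1) {v : ℝ} (hv : 1 < v) :
    DMV.poleDensity v / 2 ≤ primeDensity Θ v ∧ primeDensity Θ v ≤ 3 / 2 * DMV.poleDensity v := by
  have h := two_abs_tsum_oscTerm_le hΘ hΘ1 hv
  have h1 := abs_le.mp (show |∑' k, oscTerm Θ k v| ≤ DMV.poleDensity v / 4 by linarith)
  unfold primeDensity
  constructor <;> linarith [h1.1, h1.2]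

/-- **Positivity** of the prime density on `(1,∞)`. [cite: BrouckeDebruyne2023, §6 ("dΠ is indeed a positive measure")] -/
theorem primeDensity_nonneg (hΘ : 1 / 2 < Θ) (hΘ1 : Θ < 1) {v : ℝ} (hv : 1 < v) : 0 ≤ primeDensity Θ v :=
  le_trans (by linarith [DMV.poleDensity_nonneg hv]) (primeDensity_bounds hΘ hΘ1 hv).1

/-- The density is at most `3/2 ≤ 2` on `(1,∞)` (the bound `|f| ≤ 2` of the tree's Broucke–Vindas continuation).
[cite: BrouckeDebruyne2023, §6] -/
theorem primeDensity_le_two (hΘ : 1 / 2 < Θ) (hΘ1 : Θ < 1) {v : ℝ} (hv : 1 < v) : primeDensity Θ v ≤ 2 := by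
  have h := (primeDensity_bounds hΘ hΘ1 hv).2
  have h1 := DMV.Template.poleDensity_le_one hv
  linarith [DMV.poleDensity_nonneg hv]

/-- The density is at most `3/(2 log v)` on `(1,∞)` (Chebyshev size). [cite: BrouckeDebruyne2023, §6] -/
theorem primeDensity_le_div_log (hΘ : 1 / 2 < Θ) (hΘ1 : Θ < 1) {v : ℝ} (hv : 1 < v) :
    primeDensity Θ v ≤ 3 / 2 * (1 / Real.log v) := by
  have h := (primeDensity_bounds hΘ hΘ1 hv).2
  have h1 := DMV.poleDensity_le hv
  have : 3 / 2 * DMV.poleDensity v ≤ 3 / 2 * (1 / Real.log v) := by gcongr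
  linarith

/-- The density is at least `1/(8 log(2v))` on `(1,∞)` (so `∫₁ˣ` of it tends to `∞`).
[cite: BrouckeDebruyne2023, §6] -/
theorem primeDensity_lower (hΘ : 1 / 2 < Θ) (hΘ1 : Θ < 1) {v : ℝ} (hv : 1 < v) :
    1 / (8 * Real.log (2 * v)) ≤ primeDensity Θ v := by
  have h := (primeDensity_bounds hΘ hΘ1 hv).1
  have h1 := DMV.Template.poleDensity_ge hv
  have hlog : 0 < Real.log (2 * v) := Real.log_pos (by linarith)
  have : 1 / (8 * Real.log (2 * v)) = (1 / (4 * Real.log (2 * v))) / 2 := by field_simp; ring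
  rw [this]
  linarith

end BDTower

end Literature.NumberTheory.BeurlingPrimes

end
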